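import Mathlib
import Summits.PneNP.PneNP.Theorems.OverlapGapAlgebraSolvableImpliesStableSectionLowDensityAssemblyAux
import Summits.PneNP.PneNP.Theorems.OverlapGapAlgebraSolvableImpliesStableSectionLowDensityAssemblyCount

/-!
# Low-density assembly — stub `stub_lowDensityAssembly` of line `Sketch`, crux stmt-PneNP-2463
(`SolvableImpliesStableSection`)

For `k ≥ 3`, `0 < α ≤ 1/(32k²)`, `η > 0`, `ν ≥ 0` and every `c > 0`, the CONCLUSION of the crux holds
eventually in `n` (with `m = ⌊αn⌋`): there is a map `g` from instances to assignments which is `ν`-valid at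
all `k(mk+1)` splice points of the Bresler–Huang resampling path and moves `≤ ηn` in Hamming distance
between consecutive splice points, on at least `e^{-cn} · #Paths` of all path tuples `Ψ`.

`g` is the `toLex`-least satisfying assignment (`lds_lexMin_exists`).  On a *good* path tuple — every
splice instance satisfies Hall's condition and every pooled clause-sharing component has
`< u = 2 log₂ n + 4` clauses — each splice instance is satisfiable (`lds_sat_of_hall`), so `g` violates no
clause (`lds_viol_le`), and consecutive outputs differ on `≤ 2ku ≤ ηn` variables (`lds_stable`, from the
locality hypothesis `hLoc`).  The good tuples are at least `#Paths / 2 ≥ e^{-cn} · #Paths` by the two union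
bounds of `lds_good_card` (from `hHall`, `hBfs`, `hPeel`) and the asymptotics `hAsy`.  The five hypotheses
are the statements of the other stubs of the line.
-/

set_option linter.dupNamespace false

namespace Summit.PneNP.PneNP.Cruxes.SolvableImpliesStableSection.Sketch

open Finset
open scoped Classical

/-- **Assembly of the low-density block.** For `k ≥ 3`, `0 < α ≤ 1/(32k²)`, `η > 0`, `ν ≥ 0`, the
conclusion of the crux holds eventually in `n`, witnessed by `g :=` the `toLex`-least satisfying
assignment: good path tuples (all splice instances Hall, all pooled components `< u` clauses) lie in the
path event (`lds_viol_le`, `lds_stable`), and they are at least half of all tuples (`lds_good_card`), while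
`e^{-cn} ≤ 1/2` (asymptotics). -/
theorem stub_lowDensityAssembly (k : ℕ) (hk : 3 ≤ k) (α η ν : ℝ) (hα : 0 < α)
    (hαk : α ≤ 1 / (32 * (k : ℝ) ^ 2)) (hη : 0 < η) (hν : 0 ≤ ν)
    (hLoc : ∀ (k m n : ℕ) (Φ Φ' : Fin m → Fin k → Fin n × Bool) (a : Fin m)
      (Scl : Finset (Fin m)) (W : Finset (Fin n)),
      (∀ i, i ≠ a → Φ' i = Φ i) → a ∈ Scl →
      (∀ i ∈ Scl, ∀ j, (Φ i j).1 ∈ W ∧ (Φ' i j).1 ∈ W) →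
      (∀ i ∉ Scl, ∀ j, (Φ i j).1 ∉ W) →
      ∀ (x y : Fin n → Bool),
      ((∀ i, ∃ j, x (Φ i j).1 = (Φ i j).2) ∧
        ∀ z : Fin n → Bool, (∀ i, ∃ j, z (Φ i j).1 = (Φ i j).2) → toLex x ≤ toLex z) →
      ((∀ i, ∃ j, y (Φ' i j).1 = (Φ' i j).2) ∧
        ∀ z : Fin n → Bool, (∀ i, ∃ j, z (Φ' i j).1 = (Φ' i j).2) → toLex y ≤ toLex z) →
      hammingDist x y ≤ W.card)
    (hBfs : (∀ {V : Type} [Fintype V] [DecidableEq V] (R : V → V → Prop) (a : V) (u : ℕ) (hu : 1 ≤ u),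
      (∃ e : Fin u → V, Function.Injective e ∧ ∀ i, Relation.ReflTransGen R a (e i)) →
      ∃ f : Fin u → V, Function.Injective f ∧ f ⟨0, hu⟩ = a ∧
        ∃ p : Fin u → Fin u, Monotone p ∧ ∀ i : Fin u, (i : ℕ) ≠ 0 → p i < i ∧ R (f (p i)) (f i)) ∧
      ∀ u : ℕ, Fintype.card {p : Fin u → Fin u // Monotone p} ≤ 4 ^ u)
    (hHall : ∀ (k m n : ℕ), 1 ≤ k → 1 ≤ n → m ≤ n → ∀ (r : Fin k) (q : ℕ),
      (((Finset.univ : Finset (Fin (k + 1) → Fin m → Fin k → Fin n × Bool)).filter fun Ψ =>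
          ∃ T : Finset (Fin m),
            (T.biUnion fun i => Finset.univ.image fun j : Fin k =>
              (if (i : ℕ) * k + j < q then Ψ r.succ i j else Ψ r.castSucc i j).1).card < T.card).card : ℝ)
        ≤ (Fintype.card (Fin (k + 1) → Fin m → Fin k → Fin n × Bool) : ℝ) *
          ∑ c ∈ Finset.Icc 2 m, ((m.choose c : ℕ) : ℝ) * ((n.choose (c - 1) : ℕ) : ℝ) *
            (((c - 1 : ℕ) : ℝ) / n) ^ (k * c))
    (hPeel : ∀ (k m n : ℕ), 1 ≤ n → ∀ (r : Fin k) (u : ℕ) (f : Fin u → Fin m),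
      Function.Injective f → ∀ (p : Fin u → Fin u), (∀ i : Fin u, (i : ℕ) ≠ 0 → p i < i) →
      (((Finset.univ : Finset (Fin (k + 1) → Fin m → Fin k → Fin n × Bool)).filter fun Ψ =>
          ∀ i : Fin u, (i : ℕ) ≠ 0 → ∃ j j' : Fin k, ∃ ρ ρ' : Fin (k + 1),
            (ρ = r.castSucc ∨ ρ = r.succ) ∧ (ρ' = r.castSucc ∨ ρ' = r.succ) ∧
            (Ψ ρ (f (p i)) j).1 = (Ψ ρ' (f i) j').1).card : ℝ) * (n : ℝ) ^ (u - 1)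
        ≤ ((2 * k : ℝ) ^ 2) ^ (u - 1) *
          Fintype.card (Fin (k + 1) → Fin m → Fin k → Fin n × Bool))
    (hAsy : ∀ (k : ℕ), 3 ≤ k → ∀ (α η c : ℝ), 0 < α → α ≤ 1 / (32 * (k : ℝ) ^ 2) → 0 < η → 0 < c →
      ∀ᶠ n : ℕ in Filter.atTop,
        (k : ℝ) * ((⌊α * n⌋₊ : ℝ) * k + 1) *
            (∑ c' ∈ Finset.Icc 2 ⌊α * n⌋₊, ((⌊α * n⌋₊.choose c' : ℕ) : ℝ) *
              ((n.choose (c' - 1) : ℕ) : ℝ) * (((c' - 1 : ℕ) : ℝ) / n) ^ (k * c')) ≤ 1 / 4 ∧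
        (k : ℝ) * (⌊α * n⌋₊ : ℝ) ^ (2 * Nat.log 2 n + 4) * (4 : ℝ) ^ (2 * Nat.log 2 n + 4) *
            ((2 * k : ℝ) ^ 2 / n) ^ (2 * Nat.log 2 n + 4 - 1) ≤ 1 / 4 ∧
        2 * (k : ℝ) * ((2 * Nat.log 2 n + 4 : ℕ) : ℝ) ≤ η * n ∧
        Real.exp (-(c * n)) ≤ 1 / 2 ∧
        ⌊α * n⌋₊ ≤ n ∧ 1 ≤ n)
    (c : ℝ) (hc : 0 < c) :
    ∀ᶠ n : ℕ in Filter.atTop, ∀ m : ℕ, m = ⌊α * n⌋₊ →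
      ∃ g : (Fin m → Fin k → Fin n × Bool) → (Fin n → Bool),
        Real.exp (-(c * n)) * Fintype.card (Fin (k + 1) → Fin m → Fin k → Fin n × Bool) ≤
        ((Finset.univ.filter fun Ψ : Fin (k + 1) → Fin m → Fin k → Fin n × Bool =>
          let P : Fin k → ℕ → Fin m → Fin k → Fin n × Bool :=
            fun r q a b => if (a : ℕ) * k + b < q then Ψ r.succ a b else Ψ r.castSucc a b
          (∀ r : Fin k, ∀ q ≤ m * k, ((Finset.univ.filter fun i : Fin m =>
            ∀ j, g (P r q) (P r q i j).1 ≠ (P r q i j).2).card : ℝ) ≤ ν * m) ∧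
          ∀ r : Fin k, ∀ q < m * k,
            (hammingDist (g (P r q)) (g (P r (q + 1))) : ℝ) ≤ η * n).card : ℝ) := by
  have hk1 : 1 ≤ k := le_trans (by norm_num) hk
  filter_upwards [hAsy k hk α η c hα hαk hη hc] with n hn m hm
  subst hm
  obtain ⟨h1, h2, h3, h4, hmn, hn1⟩ := hn
  obtain ⟨g, hg⟩ := lds_lexMin_exists k ⌊α * n⌋₊ n
  refine ⟨g, ?_⟩
  have hN0 : (0 : ℝ) ≤ (Fintype.card (Fin (k + 1) → Fin ⌊α * n⌋₊ → Fin k → Fin n × Bool) : ℝ) :=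
    Nat.cast_nonneg _
  refine le_trans ?_ (lds_good_card k ⌊α * n⌋₊ n (2 * Nat.log 2 n + 4) hk1 hn1 hmn (by omega)
    hBfs hHall hPeel h1 h2 _ ?_)
  · -- `e^{-cn} · #Paths ≤ #Paths / 2`
    have h4' := mul_le_mul_of_nonneg_right h4 hN0
    linarith
  · -- good path tuples lie in the path event
    intro Ψ hH hS
    simp only [Finset.mem_filter, Finset.mem_univ, true_and]
    refine ⟨fun r q hq => ?_, fun r q hq => ?_⟩
    · -- validity: the splice instance is satisfiable, so `g` violates no clause
      exact lds_viol_le k _ n ν hν _ _ (hg _ (lds_sat_of_hall k _ n _ (hH r q hq))).1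
    · -- stability: locality across the component of the modified clause
      have hst := lds_stable k _ n hLoc g hg Ψ r q hq (hH r q hq.le) (hH r (q + 1) hq) _ (hS r)
      calc (hammingDist (g fun a b => if (a : ℕ) * k + b < q then Ψ r.succ a b
                else Ψ r.castSucc a b)
              (g fun a b => if (a : ℕ) * k + b < q + 1 then Ψ r.succ a b
                else Ψ r.castSucc a b) : ℝ)
            ≤ ((2 * k * (2 * Nat.log 2 n + 4) : ℕ) : ℝ) := by exact_mod_cast hst
        _ = 2 * (k : ℝ) * ((2 * Nat.log 2 n + 4 : ℕ) : ℝ) := by push_cast; ring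
        _ ≤ η * n := h3
end Summit.PneNP.PneNP.Cruxes.SolvableImpliesStableSection.Sketch
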